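import Summits.BirchSwinnertonDyer.BirchSwinnertonDyer.Theorems.GenusKolyvaginAtTwoVisiblePairAtTwoSupport
import HarnessLib

/-!
# Route `GenusKolyvaginAtTwo`, crux `KolyvaginExactAtTwo` (22137) → Q3-inner (24882 / 27720):
# exactness of the `ℚ`-pair instance from TWO `Input` records (levels `2^M` and `2`)

Seat `bsd-line-gk2-p2` g11 (cell `bsd-f1-sign2`). THEOREMS ONLY (no definition, no named fact, no `sorry`).

The capstone `selmer_eq_and_card_selmer_twin_eq_of_kolPrime'` (`…VisiblePairAtTwoSupport`) still displays the
bottom-level (`2`-torsion) classes `y₀ = c_1(ℓ₀)`, `uu ℓ = c_1(ℓℓ₀)`, `w ℓ = c_1(ℓ)` of McCallum's deepening argument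
together with Lemma 4.3 (`h43`), Prop. 4.4 in Selmer form (`h44sel`) and `y₀ ∈ Sel`. Here these are READ OFF a second
`Input` record `I₁ : Input W K 1 hθ hθsq` of gk2-p3 (the same data as the level-`2^M` record `I`, at level `2`):
`y₀ := I₁.c₂ ℓ₀`, `uu ℓ := I₁.c₁ (ℓ * ℓ₀)`, `w := I₁.c₂`, and

* `kolPrime_one_of_kolPrime` — a Kolyvagin prime of level `2^M` is one of level `2`;
* `kolSupp_mul_of_kolPrime`, `even_card_primeFactors_mul`, `natCast_mul_notMem` — bookkeeping for the depth `ℓℓ₀`;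
* `h43_of_input` — Lemma 4.3 for `c_1(ℓℓ₀)` off `{ℓ₀, ℓ}` from `I₁.loc_c₁_fin / loc_c₁_inf`;
* `h44sel_of_input` — Prop. 4.4 at `λ` in Selmer form from gk2-p3's `c_mem_loc_iff₂₁_field I₁`;
* `c₂_mem_selmerGroup_of_c_one_eq_zero` — `c_1(ℓ₀)` IS Selmer when `c_1(1) = δ_1(y_K) = 0` (i.e. `y_K ∈ 2E(K)`,
  `M₀ ≥ 1`): at `λ₀` by Prop. 4.4 (`c_mem_loc_iff₁₂_field I₁` with `m = 1`), elsewhere by Lemma 4.3;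
* `selmer_eq_and_card_selmer_twin_eq_of_input_pair` — **exactness of `visiblePair I`** (`Sel_{2^M}(E/ℚ) = ℤ·x`,
  `#Sel_{2^M}(E^{(d_K)}/ℚ) = 2^{2M₀}`) from `I`, `I₁` and: the Cassels–Tate data over `ℚ` (`P₁ P₂ halt hPx hnd hCTV`),
  `3 M₀ ≤ M`, a SHALLOW Kolyvagin prime `ℓ₀` of level `2` with `I₁.c₂ ℓ₀ ≠ 0` (the crux's shallow certificate in
  class form), `I₁.c₁ 1 = 0` (`M₀ ≥ 1`), Prop. 4.4 at `λ₀` in ORDER form (`h44ord`: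
  `c_1(ℓℓ₀)_{λ₀} = 0 ⟺ c_1(ℓ)_{λ₀} = 0` — the second conjunct of Q2 = stmt-24880, NOT a consequence of the Selmer-form
  field `Input.rel`), and Lemma 4.6 linking the two records (`hι : ι (I₁.c₂ ℓ) = 2^{M-1} · I.c₂ ℓ`).

BSD is not proved by any of this.

References: [McCallumLMS1991] W. G. McCallum, *Kolyvagin's work on Shafarevich–Tate groups*, LMS LNS 153 (1991),
Lemma 4.3, Prop. 4.4, Lemma 4.6, Prop. 5.2, Lemma 5.3, Thm. 5.4; [GrossLMS1991] B. H. Gross, §3, Prop. 6.2.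
-/

set_option linter.dupNamespace false -- tree convention: `Summit.BirchSwinnertonDyer.BirchSwinnertonDyer.Theorems` (summit = sub-problem)
set_option autoImplicit false

noncomputable section

open scoped Classical

namespace Summit.BirchSwinnertonDyer.BirchSwinnertonDyer.Theorems.GenusExact.VisiblePairAtTwo

open WeierstrassCurve NumberField IsDedekindDomain Field Finset Rat.HeightOneSpectrum
open Literature.NumberTheory.EllipticCurves Literature.NumberTheory.GaloisRepresentations
open Literature.NumberTheory.EllipticCurves.KolyvaginDescent

variable (W : WeierstrassCurve ℚ) [W.IsElliptic] [W.IsGloballyMinimal] (K : Type) [Field K] [NumberField K]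

/-! ## §1. Bookkeeping: levels, the depth `ℓℓ₀`, places -/

omit [W.IsElliptic] in
/-- **A Kolyvagin prime of level `2^M` (`M ≥ 1`) is a Kolyvagin prime of level `2`** (same conditions; the
index condition `M ≤ m(ℓ)` weakens to `1 ≤ m(ℓ)`, the Frobenius condition on `E[2^M]` is dropped in favour of the
one on `E[2]` already recorded). [cite: GrossLMS1991, §3 (3.1)–(3.3)] -/
theorem kolPrime_one_of_kolPrime {M : ℕ} (hM : 1 ≤ M) {ℓ : ℕ} (h : kolPrime W K M ℓ) : kolPrime W K 1 ℓ := by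
  obtain ⟨hℓ, hℓ2, hℓd, hgood, -, hF2, hidx, hinert⟩ := h
  exact ⟨hℓ, hℓ2, hℓd, hgood, by rw [pow_one]; exact hF2, hF2, le_trans hM hidx, hinert⟩

omit [W.IsElliptic] in
/-- `ℓℓ₀` is a square-free product of Kolyvagin primes for distinct Kolyvagin primes `ℓ, ℓ₀`. [folklore] -/
theorem kolSupp_mul_of_kolPrime {M : ℕ} {ℓ ℓ₀ : ℕ} (hℓ : kolPrime W K M ℓ) (hℓ₀ : kolPrime W K M ℓ₀)
    (hne : ℓ ≠ ℓ₀) : KolSupp (kolPrime W K M) (ℓ * ℓ₀) := by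
  have hℓp : ℓ.Prime := hℓ.1
  have hℓ₀p : ℓ₀.Prime := hℓ₀.1
  refine ⟨?_, fun q hq ↦ ?_⟩
  · rw [Nat.squarefree_mul ((Nat.coprime_primes hℓp hℓ₀p).mpr hne)]
    exact ⟨hℓp.prime.squarefree, hℓ₀p.prime.squarefree⟩
  · rw [Nat.primeFactors_mul hℓp.ne_zero hℓ₀p.ne_zero, Finset.mem_union, hℓp.primeFactors,
      hℓ₀p.primeFactors, Finset.mem_singleton, Finset.mem_singleton] at hq
    rcases hq with rfl | rfl
    · exact hℓ
    · exact hℓ₀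

omit [W.IsElliptic] [W.IsGloballyMinimal] in
/-- `#primeFactors(ℓℓ₀) = 2` is even for distinct primes. [folklore] -/
theorem even_card_primeFactors_mul {ℓ ℓ₀ : ℕ} (hℓp : ℓ.Prime) (hℓ₀p : ℓ₀.Prime) (hne : ℓ ≠ ℓ₀) :
    Even (ℓ * ℓ₀).primeFactors.card := by
  rw [Nat.primeFactors_mul hℓp.ne_zero hℓ₀p.ne_zero, hℓp.primeFactors, hℓ₀p.primeFactors, ← Finset.insert_eq,
    Finset.card_pair hne]
  exact even_two

omit [W.IsElliptic] [W.IsGloballyMinimal] in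
/-- A finite place other than `v_ℓ`, `v_{ℓ₀}` does not divide `ℓℓ₀`. [folklore] -/
theorem natCast_mul_notMem {ℓ ℓ₀ : ℕ} (hℓp : ℓ.Prime) (hℓ₀p : ℓ₀.Prime) {v : HeightOneSpectrum (𝓞 ℚ)}
    (hvℓ : v ≠ primesEquiv.symm ⟨ℓ, hℓp⟩) (hvℓ₀ : v ≠ primesEquiv.symm ⟨ℓ₀, hℓ₀p⟩) :
    ((ℓ * ℓ₀ : ℕ) : 𝓞 ℚ) ∉ v.asIdeal := by
  intro h
  rcases natCast_mem_or_natCast_mem_of_mul_mem h with h1 | h1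
  · exact hvℓ ((natCast_prime_mem_iff_eq hℓp v).mp h1)
  · exact hvℓ₀ ((natCast_prime_mem_iff_eq hℓ₀p v).mp h1)

omit [W.IsElliptic] [W.IsGloballyMinimal] in
/-- `loc₂` at a finite place is the Selmer local condition of the twin at its completion. [folklore] -/
theorem mem_loc₂_inl_iff (N : ℕ) (v : HeightOneSpectrum (𝓞 ℚ)) (a : galH1Torsion (twin W K) (lvl N)) :
    a ∈ loc₂ W K N (Sum.inl v) ↔ a ∈ selmerLocalKer (twin W K) (v.adicCompletion ℚ) (lvl N) := Iff.rfl

omit [W.IsElliptic] [W.IsGloballyMinimal] in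
/-- `loc₂` at an infinite place is the Selmer local condition of the twin there. [folklore] -/
theorem mem_loc₂_inr_iff (N : ℕ) (w : InfinitePlace ℚ) (a : galH1Torsion (twin W K) (lvl N)) :
    a ∈ loc₂ W K N (Sum.inr w) ↔ a ∈ selmerLocalKer (twin W K) w.Completion (lvl N) := Iff.rfl

/-! ## §2. The level-`2` inputs read off `I₁ : Input W K 1` -/

variable {W} {K} {θ : K} {hθ : θ ∉ Set.range (algebraMap ℚ K)}
  {hθsq : θ ^ 2 = algebraMap ℚ K ((NumberField.discr K : ℤ) : ℚ)}

/-- **`h43` from the level-`2` record** (Lemma 4.3): `c_1(ℓℓ₀)` is Selmer at every place other than those of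
`ℓ₀` and `ℓ`. [cite: McCallumLMS1991, Lemma 4.3 (p. 304)] -/
theorem h43_of_input (I₁ : Input W K 1 hθ hθsq) {ℓ₀ : ℕ} (hkol₀ : kolPrime W K 1 ℓ₀) :
    ∀ ℓ, kolPrime W K 1 ℓ → ℓ ≠ ℓ₀ → ∀ v, v ≠ pl ℓ₀ → v ≠ pl ℓ → I₁.c₁ (ℓ * ℓ₀) ∈ loc₁ W 1 v := by
  intro ℓ hkol hne v hv₀ hv
  have hℓp : ℓ.Prime := hkol.1
  have hℓ₀p : ℓ₀.Prime := hkol₀.1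
  have hsupp := kolSupp_mul_of_kolPrime W K hkol hkol₀ hne
  have heven := even_card_primeFactors_mul hℓp hℓ₀p hne
  rcases v with v | σ
  · rw [mem_loc₁_inl_iff]
    refine I₁.loc_c₁_fin (ℓ * ℓ₀) hsupp heven v (natCast_mul_notMem hℓp hℓ₀p ?_ ?_)
    · intro h; exact hv (by rw [h, pl_of_prime hℓp])
    · intro h; exact hv₀ (by rw [h, pl_of_prime hℓ₀p])
  · rw [mem_loc₁_inr_iff]
    exact I₁.loc_c₁_inf (ℓ * ℓ₀) hsupp heven σ

/-- **`h44sel` from the level-`2` record** (Prop. 4.4 at `λ`, Selmer form): `c_1(ℓℓ₀)` is Selmer at `λ` iff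
`c_1(ℓ₀)` vanishes at `λ` — gk2-p3's `c_mem_loc_iff₂₁_field` with `a = 0`.
[cite: McCallumLMS1991, Prop. 4.4 (p. 305)] -/
theorem h44sel_of_input (I₁ : Input W K 1 hθ hθsq) [(twin W K).IsElliptic] {ℓ₀ : ℕ} (hkol₀ : kolPrime W K 1 ℓ₀) :
    ∀ ℓ, kolPrime W K 1 ℓ → ℓ ≠ ℓ₀ → (I₁.c₁ (ℓ * ℓ₀) ∈ loc₁ W 1 (pl ℓ) ↔ I₁.c₂ ℓ₀ ∈ a₂ W K 1 ℓ) := by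
  intro ℓ hkol hne
  have hℓ₀p : ℓ₀.Prime := hkol₀.1
  have hodd : Odd ℓ₀.primeFactors.card := by
    rw [hℓ₀p.primeFactors, Finset.card_singleton]; exact odd_one
  simpa only [pow_zero, one_zsmul] using
    c_mem_loc_iff₂₁_field I₁ ℓ ℓ₀ hkol (kolSupp_mul_of_kolPrime W K hkol hkol₀ hne) hodd 0

/-- **`c_1(ℓ₀)` is Selmer when `c_1(1) = 0`**: for a Kolyvagin prime `ℓ₀` of level `2` and a level-`2` record with
`c₁ 1 = 0` (i.e. `δ_1(y_K) = 0`, `y_K ∈ 2E(K)`, `M₀ ≥ 1`), the class `c₂ ℓ₀ = c_1(ℓ₀) ∈ H¹(ℚ, E^{(d_K)}[2])` is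
Selmer: at `λ₀` by Prop. 4.4 (`c_mem_loc_iff₁₂_field` with `m = 1`: Selmer at `λ₀ ⟺ c_1(1)_{λ₀} = 0`), at the
other finite places and at `∞` by Lemma 4.3 (`loc_c₂_fin`, `loc_c₂_inf`).
[cite: McCallumLMS1991, Lemma 4.3 and Prop. 4.4 (pp. 304–305)] -/
theorem c₂_mem_selmerGroup_of_c_one_eq_zero (I₁ : Input W K 1 hθ hθsq) [(twin W K).IsElliptic] {ℓ₀ : ℕ}
    (hkol₀ : kolPrime W K 1 ℓ₀) (h0 : I₁.c₁ 1 = 0) : I₁.c₂ ℓ₀ ∈ selmerGroup (twin W K) (lvl 1) := by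
  have hℓ₀p : ℓ₀.Prime := hkol₀.1
  have hsupp : KolSupp (kolPrime W K 1) ℓ₀ := kolSupp_prime hℓ₀p hkol₀
  have hodd : Odd ℓ₀.primeFactors.card := by
    rw [hℓ₀p.primeFactors, Finset.card_singleton]; exact odd_one
  -- at `λ₀`: Prop. 4.4 with `m = 1`, `a = 0`
  have hpl0 : I₁.c₂ ℓ₀ ∈ loc₂ W K 1 (pl ℓ₀) := by
    have hsupp1 : KolSupp (kolPrime W K 1) (ℓ₀ * 1) := by rw [mul_one]; exact hsupp
    have heven1 : Even (1 : ℕ).primeFactors.card := by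
      rw [Nat.primeFactors_one, Finset.card_empty]; exact ⟨0, rfl⟩
    have h := (c_mem_loc_iff₁₂_field I₁ ℓ₀ 1 hkol₀ hsupp1 heven1 0).mpr
      (by rw [h0, zsmul_zero]; exact zero_mem _)
    rwa [pow_zero, one_zsmul, mul_one] at h
  rw [mem_selmerGroup_iff]
  refine ⟨fun v ↦ ?_, fun σ ↦ I₁.loc_c₂_inf ℓ₀ hsupp hodd σ⟩
  by_cases hv : v = primesEquiv.symm ⟨ℓ₀, hℓ₀p⟩
  · rw [← mem_loc₂_inl_iff, hv, ← pl_of_prime hℓ₀p]; exact hpl0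
  · exact I₁.loc_c₂_fin ℓ₀ hsupp hodd v (fun h ↦ hv ((natCast_prime_mem_iff_eq hℓ₀p v).mp h))

/-! ## §3. Exactness of the instance from the pair of records -/

variable {M : ℕ}

/-- **Exactness of `visiblePair I` from two `Input` records and a SHALLOW certificate.** For the `ℚ`-pair instance of
gk2-p3 at level `2^M` (`I`) together with its level-`2` companion (`I₁`): `Sel_{2^M}(E/ℚ) = ℤ·x` and
`#Sel_{2^M}(E^{(d_K)}/ℚ) = 2^{2M₀}`, GIVEN — besides the habitat — the Cassels–Tate data over `ℚ`
(`P₁ P₂ halt₁ halt₂ hPx hnd₁ hnd₂ hCTV`), `3 M₀ ≤ M`, a shallow Kolyvagin prime `ℓ₀` of level `2` with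
`I₁.c₂ ℓ₀ ≠ 0` (`c_1(ℓ₀) ≠ 0`, i.e. `P_{ℓ₀} ∉ 2E(K)`: the crux's SHALLOW certificate), `I₁.c₁ 1 = 0` (`M₀ ≥ 1`),
Prop. 4.4 at `λ₀` in ORDER form for the level-`2` classes (`h44ord`, second conjunct of Q2 = stmt-24880), and
Lemma 4.6 linking the records (`hι`). Discharged inside: Čebotarev (`Input.cebotarev`, `hCeb`), the reciprocity /
local-duality / transfer inputs of the deepening, visibility from (H2), the auxiliary class (Poitou–Tate), the
support conditions, and the level-`2` bookkeeping `h43 / h44sel / y₀ ∈ Sel` (this file).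
[cite: McCallumLMS1991, Prop. 5.2 (pp. 308–310), Lemma 4.3, Prop. 4.4, Lemma 4.6, Lemma 5.3, Thm. 5.4] -/
theorem selmer_eq_and_card_selmer_twin_eq_of_input_pair (I : Input W K M hθ hθsq) (I₁ : Input W K 1 hθ hθsq)
    (hcm : ¬ W.HasCM) (hΔ : W.Δ < 0) (hK : IsImaginaryQuadratic K) (hodd : Odd (NumberField.discr K))
    (hns : ¬ IsSquare ((NumberField.discr K : ℚ) * -|W.Δ|))
    (hρ : ∀ n : ℕ, W.HasSurjectiveModNGaloisRep (2 ^ n : ℕ)) [(twin W K).IsElliptic] (hM : 1 ≤ M)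
    (P₁ : (visiblePair I).Sel₁ →+ (visiblePair I).Sel₁ →+ AddCircle (1 : ℚ)) (halt₁ : ∀ z, P₁ z z = 0)
    (hPx : ∀ t, P₁ ⟨(visiblePair I).x, (visiblePair I).x_mem⟩ t = 0)
    (hnd₁ : ∀ z : (visiblePair I).Sel₁, (∀ t, P₁ z t = 0) →
      (z : galH1Torsion W (lvl M)) ∈ AddSubgroup.zmultiples (visiblePair I).x)
    (P₂ : (visiblePair I).Sel₂ →+ (visiblePair I).Sel₂ →+ AddCircle (1 : ℚ)) (halt₂ : ∀ z, P₂ z z = 0)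
    (hnd₂ : ∀ z : (visiblePair I).Sel₂, (∀ t, P₂ z t = 0) → z = 0)
    (hCTV : ∀ ℓ m : ℕ, (visiblePair I).Kol ℓ → KolSupp (visiblePair I).Kol (ℓ * m) → ¬ ℓ ∣ m →
      ∀ (j N a b : ℕ) (t : galH1Torsion W (lvl M) × galH1Torsion (twin W K) (lvl M))
        (ht : t ∈ (visiblePair I).toVisibleSplit.Sel)
        (hz : (((visiblePair I).p : ℤ) ^ j) • (visiblePair I).toVisibleSplit.c (ℓ * m) ∈
          (visiblePair I).toVisibleSplit.Sel),
      (((visiblePair I).p : ℤ) ^ N) • t = 0 →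
      t ∈ (visiblePair I).toVisibleSplit.part (1 * (-1) ^ (ℓ * m).primeFactors.card) →
      (∀ q ∈ m.primeFactors, t ∈ (visiblePair I).toVisibleSplit.A q) →
      (visiblePair I).M - (visiblePair I).M₀ ≤ j → N + (visiblePair I).M₀ ≤ (visiblePair I).M → N ≤ j →
      a + b + 1 = N →
      (((visiblePair I).p : ℤ) ^ (a + (j - N))) • (visiblePair I).toVisibleSplit.c m ∉
        (visiblePair I).toVisibleSplit.A ℓ →
      (((visiblePair I).p : ℤ) ^ b) • t ∉ (visiblePair I).toVisibleSplit.A ℓ →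
      (visiblePair I).prodPairing P₁ P₂ ⟨_, hz⟩ ⟨t, ht⟩ ≠ 0)
    (h3 : 3 * I.M₀ ≤ M)
    -- the shallow certificate, in class form, and the remaining level-`2` inputs
    {ℓ₀ : ℕ} (hkol₀ : kolPrime W K 1 ℓ₀) (hy0 : I₁.c₂ ℓ₀ ≠ 0) (h0 : I₁.c₁ 1 = 0)
    (h44ord : ∀ ℓ, kolPrime W K M ℓ → ℓ ≠ ℓ₀ → (I₁.c₁ (ℓ * ℓ₀) ∈ a₁ W 1 ℓ₀ ↔ I₁.c₂ ℓ ∈ a₂ W K 1 ℓ₀))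
    (hι : ∀ ℓ, kolPrime W K M ℓ →
      torsionH1OfDvd (twin W K) (lvl_one_dvd_lvl hM) (I₁.c₂ ℓ) = ((2 : ℤ) ^ (M - 1)) • I.c₂ ℓ) :
    selmerGroup W (lvl M) = AddSubgroup.zmultiples I.x ∧
      Nat.card (selmerGroup (twin W K) (lvl M)) = 2 ^ (2 * I.M₀) :=
  selmer_eq_and_card_selmer_twin_eq_of_kolPrime' I hcm hΔ hK hodd hns hρ hM P₁ halt₁ hPx hnd₁ P₂ halt₂ hnd₂ hCTV
    h3 hkol₀ (I₁.c₂ ℓ₀) hy0 (c₂_mem_selmerGroup_of_c_one_eq_zero I₁ hkol₀ h0) (fun ℓ ↦ I₁.c₁ (ℓ * ℓ₀)) I₁.c₂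
    (fun ℓ hℓ hne ↦ h43_of_input I₁ hkol₀ ℓ (kolPrime_one_of_kolPrime W K hM hℓ) hne)
    (fun ℓ hℓ hne ↦ h44sel_of_input I₁ hkol₀ ℓ (kolPrime_one_of_kolPrime W K hM hℓ) hne) h44ord hι

/-! ### The same capstone with the value formula restricted to `2^{2M₀}`-torsion classes

Appended by seat `bsd-line-gk2-p2` g12: `selmer_eq_and_card_selmer_twin_eq_of_input_pair` VERBATIM, with `hCTV` assumed only for `t` with
`2^{2M₀} t = 0` — the only classes the telescope applies it to (Selmer eigenclasses independent of `x`,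
Literature `exists_chain_of_casselsTate_of_torsion`), and the form in which the Cassels–Tate pairings pulled
back to `Sel_{2^M}` actually satisfy it. -/

/-- **`selmer_eq_and_card_selmer_twin_eq_of_input_pair`, value formula on `2^{2M₀}`-torsion classes only** (extra antecedent
`2^{2M₀} t = 0` in `hCTV`; everything else verbatim). [cite: McCallumLMS1991, Prop. 5.2, Thm. 5.4, Cor. 5.6]
[cite: Kolyvagin1989Izv, §3] -/
theorem selmer_eq_and_card_selmer_twin_eq_of_input_pair_of_torsion (I : Input W K M hθ hθsq) (I₁ : Input W K 1 hθ hθsq)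
    (hcm : ¬ W.HasCM) (hΔ : W.Δ < 0) (hK : IsImaginaryQuadratic K) (hodd : Odd (NumberField.discr K))
    (hns : ¬ IsSquare ((NumberField.discr K : ℚ) * -|W.Δ|))
    (hρ : ∀ n : ℕ, W.HasSurjectiveModNGaloisRep (2 ^ n : ℕ)) [(twin W K).IsElliptic] (hM : 1 ≤ M)
    (P₁ : (visiblePair I).Sel₁ →+ (visiblePair I).Sel₁ →+ AddCircle (1 : ℚ)) (halt₁ : ∀ z, P₁ z z = 0)
    (hPx : ∀ t, P₁ ⟨(visiblePair I).x, (visiblePair I).x_mem⟩ t = 0)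
    (hnd₁ : ∀ z : (visiblePair I).Sel₁, (∀ t, P₁ z t = 0) →
      (z : galH1Torsion W (lvl M)) ∈ AddSubgroup.zmultiples (visiblePair I).x)
    (P₂ : (visiblePair I).Sel₂ →+ (visiblePair I).Sel₂ →+ AddCircle (1 : ℚ)) (halt₂ : ∀ z, P₂ z z = 0)
    (hnd₂ : ∀ z : (visiblePair I).Sel₂, (∀ t, P₂ z t = 0) → z = 0)
    (hCTV : ∀ ℓ m : ℕ, (visiblePair I).Kol ℓ → KolSupp (visiblePair I).Kol (ℓ * m) → ¬ ℓ ∣ m →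
      ∀ (j N a b : ℕ) (t : galH1Torsion W (lvl M) × galH1Torsion (twin W K) (lvl M))
        (ht : t ∈ (visiblePair I).toVisibleSplit.Sel)
        (hz : (((visiblePair I).p : ℤ) ^ j) • (visiblePair I).toVisibleSplit.c (ℓ * m) ∈
          (visiblePair I).toVisibleSplit.Sel),
      (((visiblePair I).p : ℤ) ^ N) • t = 0 → (((visiblePair I).p : ℤ) ^ (2 * (visiblePair I).M₀)) • t = 0 →
      t ∈ (visiblePair I).toVisibleSplit.part (1 * (-1) ^ (ℓ * m).primeFactors.card) →
      (∀ q ∈ m.primeFactors, t ∈ (visiblePair I).toVisibleSplit.A q) →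
      (visiblePair I).M - (visiblePair I).M₀ ≤ j → N + (visiblePair I).M₀ ≤ (visiblePair I).M → N ≤ j →
      a + b + 1 = N →
      (((visiblePair I).p : ℤ) ^ (a + (j - N))) • (visiblePair I).toVisibleSplit.c m ∉
        (visiblePair I).toVisibleSplit.A ℓ →
      (((visiblePair I).p : ℤ) ^ b) • t ∉ (visiblePair I).toVisibleSplit.A ℓ →
      (visiblePair I).prodPairing P₁ P₂ ⟨_, hz⟩ ⟨t, ht⟩ ≠ 0)
    (h3 : 3 * I.M₀ ≤ M)
    -- the shallow certificate, in class form, and the remaining level-`2` inputs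
    {ℓ₀ : ℕ} (hkol₀ : kolPrime W K 1 ℓ₀) (hy0 : I₁.c₂ ℓ₀ ≠ 0) (h0 : I₁.c₁ 1 = 0)
    (h44ord : ∀ ℓ, kolPrime W K M ℓ → ℓ ≠ ℓ₀ → (I₁.c₁ (ℓ * ℓ₀) ∈ a₁ W 1 ℓ₀ ↔ I₁.c₂ ℓ ∈ a₂ W K 1 ℓ₀))
    (hι : ∀ ℓ, kolPrime W K M ℓ →
      torsionH1OfDvd (twin W K) (lvl_one_dvd_lvl hM) (I₁.c₂ ℓ) = ((2 : ℤ) ^ (M - 1)) • I.c₂ ℓ) :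
    selmerGroup W (lvl M) = AddSubgroup.zmultiples I.x ∧
      Nat.card (selmerGroup (twin W K) (lvl M)) = 2 ^ (2 * I.M₀) :=
  selmer_eq_and_card_selmer_twin_eq_of_kolPrime_of_torsion' I hcm hΔ hK hodd hns hρ hM P₁ halt₁ hPx hnd₁ P₂ halt₂ hnd₂ hCTV
    h3 hkol₀ (I₁.c₂ ℓ₀) hy0 (c₂_mem_selmerGroup_of_c_one_eq_zero I₁ hkol₀ h0) (fun ℓ ↦ I₁.c₁ (ℓ * ℓ₀)) I₁.c₂
    (fun ℓ hℓ hne ↦ h43_of_input I₁ hkol₀ ℓ (kolPrime_one_of_kolPrime W K hM hℓ) hne)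
    (fun ℓ hℓ hne ↦ h44sel_of_input I₁ hkol₀ ℓ (kolPrime_one_of_kolPrime W K hM hℓ) hne) h44ord hι

end Summit.BirchSwinnertonDyer.BirchSwinnertonDyer.Theorems.GenusExact.VisiblePairAtTwo
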